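import Summits.FinalStateConjecture.FinalStateConjecture.Theorems.EIHFluxBalanceInertialRecessionStubEndgameOracleMixedIncrement
import Summits.FinalStateConjecture.FinalStateConjecture.Theorems.EIHFluxBalanceInertialRecessionStubEndgameOracleMixedShort

/-!
# Route EIHFluxBalance — crux `InertialRecession`, line `sublinear-is-free-clean-window-charges`:
# the increment oracle for a slow PAIR with ballistic outsiders — the three segment types

Helper file for the crux `stmt-FinalStateConjecture-10166`
(`Summit.FinalStateConjecture.FinalStateConjecture.Theses.EIHFluxBalance.InertialRecession`), registered stub `stub_incrementOracle`
(lead reshape r9/r10) of `Cruxes/InertialRecession/Lines/sublinear_is_free_clean_window_charges.lean`; lead's roadmap §9 (case `|S| = 2`).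

For `S = {k, l}` (internally slow) whose outsiders `O = univ ∖ S` are ballistic relative to `k` and to `l` (floor `W/2`, distance `≥ A₀`),
the interval `[t₁,t₂]` is cut into segments of three types, each handled by ONE or TWO explicit window paths:
* `pair_increment_spread` — SPREAD pair (`‖ξₖ − ξₗ‖ ≥ (c₀/4)s`): two singleton windows, the partner is a FAR non-member
  (`tight_increment_mixed` with `F = {partner}`);
* `pair_increment_compact` — COMPACT pair outside passages (`‖ξₖ − ξₗ‖ ≤ min(c₀s, (2/3)min_{m∈O}‖ξₘ − ξₖ‖)/2`): one pair window about `ξₖ`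
  (`tight_increment_mixed` with `F = ∅`);
* `singleton_increment_passage` — during a passage: a singleton window whose partner is a NEAR-but-SHORT non-member at distance `≥ A₁`
  (`increment_of_windowPath` + `integral_radius_le_mixed3` with `G = {partner}`), cost `2(t₂ − t₁)(A₁√A₁)⁻¹` extra.
-/

noncomputable section

set_option linter.dupNamespace false

open Filter Topology Set MeasureTheory intervalIntegral
open scoped Topology BigOperators InnerProductSpace RealInnerProductSpace

namespace Summit.FinalStateConjecture.FinalStateConjecture.Theorems.SublinearIsFree.Oracle

open Literature.Geometry.Lorentzian
open Summit.FinalStateConjecture.FinalStateConjecture.Theorems.SublinearIsFree.Endgame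
open Summit.FinalStateConjecture.FinalStateConjecture.Theorems.SublinearIsFree.Toy

set_option maxHeartbeats 800000 in
/-- **A SINGLETON WINDOW DURING A PASSAGE** (near-but-short partner `l` at distance `≥ A₁`, ballistic outsiders `B = univ ∖ {k,l}`):
the energy and momentum components of hole `k` change on `[t₁,t₂]` by at most
`C·(2c₀^{-3/2}t₁^{-1/2} + |B|·2·2√2·8/(W√A₀) + 2(t₂ − t₁)(A₁√A₁)⁻¹) + ζ(t₁) + ζ(t₂)`. [folklore] -/
theorem singleton_increment_passage {N : ℕ} (M : Fin N → ℝ) (ξ v : Fin N → ℝ → E3) (κ : ℝ) (P : ℝ → E3 → ℝ → Fin 4 → ℝ)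
    (ρ : ℝ → ℝ) (C T T' T₀ : ℝ) (ζ : ℝ → ℝ)
    (hWL : ∀ (t₁ t₂ : ℝ) (c : ℝ → E3) (R : ℝ → ℝ), T ≤ t₁ → t₁ ≤ t₂ →
      (∀ s ∈ Set.Icc t₁ t₂, ∀ s' ∈ Set.Icc t₁ t₂, ‖c s - c s'‖ ≤ 2 * |s - s'| ∧ |R s - R s'| ≤ 2 * |s - s'|) →
      (∀ s ∈ Set.Icc t₁ t₂, ρ s ≤ (1 / 2) * R s ∧ ‖c s‖ + R s ≤ (κ + κ ^ 2) / 2 * s ∧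
        ∀ j, ‖ξ j s - c s‖ ≤ (1 - 1 / 2) * R s ∨ (1 + 1 / 2) * R s ≤ ‖ξ j s - c s‖) →
      ∀ μ : Fin 4, |P t₂ (c t₂) (R t₂) μ - P t₁ (c t₁) (R t₁) μ| ≤ C * ∫ s in t₁..t₂, (R s ^ (3 / 2 : ℝ))⁻¹)
    (hID : ∀ (t : ℝ) (c : E3) (R : ℝ) (A : Finset (Fin N)), T' ≤ t → ρ t ≤ (1 / 2) * R →
      ‖c‖ + R ≤ (κ + κ ^ 2) / 2 * t →
      (∀ j, ‖ξ j t - c‖ ≤ (1 - 1 / 2) * R ∨ (1 + 1 / 2) * R ≤ ‖ξ j t - c‖) →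
      (∀ j, j ∈ A ↔ ‖ξ j t - c‖ ≤ (1 - 1 / 2) * R) →
      |P t c R 0 - ∑ j ∈ A, M j * (√(1 - ‖v j t‖ ^ 2))⁻¹| ≤ ζ t ∧
      ∀ k : Fin 3, |P t c R k.succ - ∑ j ∈ A, M j * (√(1 - ‖v j t‖ ^ 2))⁻¹ * v j t k| ≤ ζ t)
    (hC : 0 ≤ C) (hκ0 : 0 < κ) (hκ1 : κ < 1)
    (hξ : ∀ i, ContDiff ℝ 1 (ξ i)) (hspeed1 : ∀ i s, T₀ ≤ s → ‖deriv (ξ i) s‖ ≤ 1)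
    {k l : Fin N} (hkl : k ≠ l)
    {t₁ t₂ W A₀ A₁ : ℝ} (hT : T ≤ t₁) (hT' : T' ≤ t₁) (hT₀ : T₀ ≤ t₁) (ht₁ : 0 < t₁) (h12 : t₁ ≤ t₂)
    (hW : 0 < W) (hA₀ : 0 < A₀) (hA₁ : 0 < A₁)
    (hcone : ∀ s ∈ Set.Icc t₁ t₂, ‖ξ k s‖ ≤ κ ^ 2 * s)
    (n : Fin N → E3) (hn : ∀ j ∈ Finset.univ \ {k, l}, ‖n j‖ = 1)
    (hball : ∀ j ∈ Finset.univ \ {k, l}, ∀ s ∈ Icc t₁ t₂, W / 2 ≤ ⟪deriv (ξ j) s - deriv (ξ k) s, n j⟫)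
    (hfarB : ∀ j ∈ Finset.univ \ {k, l}, ∀ s ∈ Icc t₁ t₂, A₀ ≤ ‖ξ j s - ξ k s‖)
    (hnear : ∀ s ∈ Icc t₁ t₂, A₁ ≤ ‖ξ l s - ξ k s‖)
    (hρ : ∀ s ∈ Set.Icc t₁ t₂, (∀ j, j ≠ k → ρ s ≤ ‖ξ j s - ξ k s‖ / 3) ∧ ρ s ≤ (κ - κ ^ 2) / 2 * s / 2) :
    |M k * (√(1 - ‖v k t₂‖ ^ 2))⁻¹ - M k * (√(1 - ‖v k t₁‖ ^ 2))⁻¹| ≤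
        C * (2 * (((κ - κ ^ 2) / 2) ^ (3 / 2 : ℝ))⁻¹ * (t₁ ^ (1 / 2 : ℝ))⁻¹ +
          (Finset.univ \ {k, l}).card * (2 * (2 * √2 * (8 / (W * √A₀)))) + 2 * ((t₂ - t₁) * (A₁ * √A₁)⁻¹)) + ζ t₁ + ζ t₂ ∧
    ∀ kk : Fin 3, |M k * (√(1 - ‖v k t₂‖ ^ 2))⁻¹ * v k t₂ kk - M k * (√(1 - ‖v k t₁‖ ^ 2))⁻¹ * v k t₁ kk| ≤
        C * (2 * (((κ - κ ^ 2) / 2) ^ (3 / 2 : ℝ))⁻¹ * (t₁ ^ (1 / 2 : ℝ))⁻¹ +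
          (Finset.univ \ {k, l}).card * (2 * (2 * √2 * (8 / (W * √A₀)))) + 2 * ((t₂ - t₁) * (A₁ * √A₁)⁻¹)) + ζ t₁ + ζ t₂ := by
  classical
  set c₀ : ℝ := (κ - κ ^ 2) / 2 with hc₀def
  have hκκ : 0 < κ - κ ^ 2 := by nlinarith
  have hc₀ : 0 < c₀ := by positivity
  set Sc : Finset (Fin N) := Finset.univ \ {k} with hScdef
  have hSc : Sc.Nonempty := ⟨l, by simp [hScdef, hkl.symm]⟩
  set B : Finset (Fin N) := Finset.univ \ {k, l} with hBdef
  have hBFG : ∀ j ∈ Sc, j ∈ B ∨ j ∈ (∅ : Finset (Fin N)) ∨ j ∈ ({l} : Finset (Fin N)) := by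
    intro j hj
    by_cases hjl : j = l
    · right; right; simp [hjl]
    · left
      have hjk : j ≠ k := by simpa [hScdef] using hj
      simp [hBdef, hjk, hjl]
  set D : ℝ → ℝ := fun s ↦ Sc.inf' hSc fun j ↦ ‖ξ j s - ξ k s‖ with hD
  set R : ℝ → ℝ := fun s ↦ min (c₀ * s) (2 / 3 * D s) with hR
  have hdiff : ∀ i, Differentiable ℝ (ξ i) := fun i ↦ (hξ i).differentiable one_ne_zero
  have hmemSc : ∀ j, j ∈ Sc ↔ j ≠ k := fun j ↦ by simp [hScdef]
  have hDle : ∀ s, ∀ j, j ≠ k → D s ≤ ‖ξ j s - ξ k s‖ := fun s j hj ↦ Finset.inf'_le _ ((hmemSc j).mpr hj)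
  have hDpos : ∀ s ∈ Set.Icc t₁ t₂, 0 < D s := by
    intro s hs
    obtain ⟨j, hj, hjmin⟩ := Finset.exists_mem_eq_inf' hSc (fun j ↦ ‖ξ j s - ξ k s‖)
    simp only [hD]; rw [hjmin]
    rcases hBFG j hj with h | h | h
    · exact hA₀.trans_le (hfarB j h s hs)
    · simp at h
    · have : j = l := by simpa using h
      subst this; exact hA₁.trans_le (hnear s hs)
  have hRpos : ∀ s ∈ Set.Icc t₁ t₂, 0 < R s := fun s hs ↦
    lt_min (mul_pos hc₀ (ht₁.trans_le hs.1)) (by have := hDpos s hs; positivity)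
  have hRlip : ∀ s ∈ Set.Icc t₁ t₂, ∀ s' ∈ Set.Icc t₁ t₂, |R s - R s'| ≤ 2 * |s - s'| := by
    intro s hs s' hs'
    have hDlip : |D s - D s'| ≤ 2 * |s - s'| :=
      abs_inf'_sub_inf'_le Sc hSc (fun j σ ↦ ‖ξ j σ - ξ k σ‖) fun j _ ↦
        abs_dist_sub_dist_le_two (hdiff j) (hdiff k) (fun t ht ↦ hspeed1 j t ht) (fun t ht ↦ hspeed1 k t ht)
          (hT₀.trans hs.1) (hT₀.trans hs'.1)
    have h1 : |c₀ * s - c₀ * s'| ≤ 2 * |s - s'| := by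
      rw [← mul_sub, abs_mul, abs_of_pos hc₀]
      have hc₀1 : c₀ ≤ 1 := by rw [hc₀def]; nlinarith
      have := abs_nonneg (s - s')
      nlinarith
    have h2 : |2 / 3 * D s - 2 / 3 * D s'| ≤ 2 * |s - s'| := by
      rw [← mul_sub, abs_mul, abs_of_pos (by norm_num : (0 : ℝ) < 2 / 3)]
      have := abs_nonneg (s - s')
      nlinarith
    calc |R s - R s'| ≤ max |c₀ * s - c₀ * s'| |2 / 3 * D s - 2 / 3 * D s'| := abs_min_sub_min_le _ _ _ _
      _ ≤ 2 * |s - s'| := max_le h1 h2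
  have hcap : ∀ s ∈ Set.Icc t₁ t₂, ‖ξ k s‖ + R s ≤ (κ + κ ^ 2) / 2 * s := by
    intro s hs
    have h1 : R s ≤ c₀ * s := min_le_left _ _
    have h2 := hcone s hs
    have : κ ^ 2 * s + c₀ * s = (κ + κ ^ 2) / 2 * s := by rw [hc₀def]; ring
    linarith
  have hnon : ∀ s ∈ Set.Icc t₁ t₂, ∀ j ∉ ({k} : Finset (Fin N)), 3 * R s / 2 ≤ ‖ξ j s - ξ k s‖ := by
    intro s hs j hj
    have hj' : j ≠ k := by simpa using hj
    have h1 : R s ≤ 2 / 3 * D s := min_le_right _ _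
    have h2 := hDle s j hj'
    linarith
  have hρ' : ∀ s ∈ Set.Icc t₁ t₂, ρ s ≤ R s / 2 := by
    intro s hs
    obtain ⟨j, hj, hjmin⟩ := Finset.exists_mem_eq_inf' hSc (fun j ↦ ‖ξ j s - ξ k s‖)
    have hjk : j ≠ k := (hmemSc j).mp hj
    have h1 := (hρ s hs).1 j hjk
    have h2 := (hρ s hs).2
    have hDj : D s = ‖ξ j s - ξ k s‖ := by simp only [hD]; exact hjmin
    simp only [hR]
    rcases min_choice (c₀ * s) (2 / 3 * D s) with h | h <;> rw [h]
    · rw [hc₀def] at *; linarith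
    · rw [hDj]; linarith
  have hmem : ∀ s ∈ Set.Icc t₁ t₂, ∀ i ∈ ({k} : Finset (Fin N)), ‖ξ i s - ξ k s‖ ≤ R s / 2 := by
    intro s hs i hi
    have : i = k := by simpa using hi
    subst this; simp only [sub_self, norm_zero]; linarith [hRpos s hs]
  have hinc := increment_of_windowPath M ξ v κ P ρ C T T' T₀ ζ hWL hID hdiff
    (fun i s hs ↦ (hspeed1 i s hs).trans (by norm_num)) hT hT' hT₀ h12 hRlip hRpos hρ' hcap hmem hnon (A := {k}) (a := k)
  have hint := integral_radius_le_mixed3 ξ hξ Sc B ∅ {l} hSc hBFG k ht₁ h12 hc₀ hW hA₀ one_pos hA₁ n hn hball hfarB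
    (fun j hj ↦ absurd hj (Finset.notMem_empty j)) (fun j hj s hs ↦ by
      have : j = l := by simpa using hj
      subst this; exact hnear s hs)
  have hbound := mul_le_mul_of_nonneg_left hint hC
  simp only [Finset.card_empty, Nat.cast_zero, zero_mul, add_zero, Finset.card_singleton, Nat.cast_one, one_mul] at hbound
  simp only [Finset.sum_singleton] at hinc
  exact ⟨hinc.1.trans (by linarith), fun kk ↦ (hinc.2 kk).trans (by linarith)⟩

/-- Registered helper form: a pair has `N − 2` outsiders (carrier of this file). [folklore] -/
theorem oracle_card_univ_sdiff_pair : ∀ (N : ℕ) (k l : Fin N), k ≠ l → (Finset.univ \ ({k, l} : Finset (Fin N))).card = N - 2 := by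
  intro N k l hkl
  rw [Finset.card_univ_sdiff, Finset.card_pair hkl, Fintype.card_fin]

end Summit.FinalStateConjecture.FinalStateConjecture.Theorems.SublinearIsFree.Oracle

end
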